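import Summits.HodgeConjecture.HodgeConjecture.Theorems.F0LD1ThetaArchCompactStep
import Literature.NumberTheory.GelbartRogawski1991.DoubledWeilRepresentationArchPlacePhaseNeg
import Literature.NumberTheory.Weil1964.ArchMetaplecticSplittingsHolds
import HarnessLib

-- statements over the theta-kernel datum elaborate to very large types; elaborate sequentially (as in the ★ kit lineage)
set_option Elab.async false

/-!
# (Gα-C∞, definite step, NEGATIVE pair form) the twin of ★ `F0LD1ThetaArchCompactStep` at a real place where every sign `x_{v₀}(k) < 0`
# (line LD1 of crux HLiu418, brick (Gα-C∞) `ArchLadder`, LD1-plan (g2) DEALS #9-bis; owner A-p16 (g35), plate (P1⁻))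

Cell hodgecm-mathlib, floor 0; namespace `Summit.HodgeConjecture.HodgeConjecture.Cruxes.HLiu418.F0LD1ThetaArchCompactStepNeg`;
`--supports stmt-HodgeConjecture-24832 --as helper`.  THEOREMS ONLY (no definition, no instance, no notation, no `sorry`).

THE POINT.  ★ `F0LD1ThetaArchCompactStep` treats a real place where the pair form is positive; at a DEFINITE place the sign vector `x_{v₀}` has CONSTANT sign, but it
may be negative (`x_{v₀}(k) = σ_{v₀}(dV_p) σ_{v₀}(dW_0) ∕ Im σ_{w₀}(δ)`), and the ladder needs both.  Here `v₀` is a real place at which the pair form is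
NEGATIVE (`hneg`: every sign `x_{v₀}(k) < 0`), the phase matrix `W` carries NO complex conjugation (★ `GRConstruction.exists_sectionD_archKPlace_apply_of_neg`,
★ `exists_archLocal_entries_eq_of_neg`) and Folland's section has the vacuum coefficient `vac = ((det u)^M)⁻¹` (★ `vac_sectionD_archKPlace_of_neg`), kept
symbolic and only used through ★ `MpS.vac_ne_zero`.  Let `u ∈ U(σ_{w₀} diag dV)(ℂ)` ANY element (the whole group is compact
there), `W = D (u ⊗ 1)^{e₁} D⁻¹ ∈ U(n′)` its unitary matrix in the scaled Folland frame (`D = diag √|x_{v₀}|`; the shape `hW` of ★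
`GRConstruction.exists_sectionD_archKPlace_apply_of_neg`), and `k ∈ U(H)(𝔸)` with `ιA k = adelicSingle w₀ u`.  Then
* §1 `carrierConjEquiv_frameD_sectionD_archKPlace_of_neg` — the BOX IDENTITY: Folland's section at `k_{v₀,u}` acts on the re-enumerated box tensor
  `R_{e₂}(h^V_{β₁} ⊠ h^V_{β₂})` by `vac • R_{e₂}((μ₀(W at v₀))^{frameV} h^V_{β₁} ⊠ h^V_{β₂})` (★ `exists_sectionD_archKPlace_apply_of_neg` + ★ β-II).
* §2 **`rightRegular_toLp_lineThetaLift_follandHermite_of_eq_adelicSingle_of_neg`**: `R(k) [θ_{h_β ⊗ Φ_f}] = (η_D(u) · vac) • [θ_{(μ₀(W at v₀))^{frameV} h_β ⊗ Φ_f}]`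
  in `L²([U(H)], ν)` (★ K1 `rightRegular_toLp_lineThetaLift`, ★ T2 `pairRep_chiSplittingLine_adelicSingle_tmul_of_box`, §1).
* §3 **`charProjL_rightRegular_thetaClass_follandHermite_of_neg`**: the full-torus projector of type `c_γ` sends `R(k) [θ_{h_β ⊗ Φ_f}]` to
  `(η_D(u) · vac · uKernel (W at v₀) γ β) • [θ_{h_γ ⊗ Φ_f}]` (★ §2′ `hermiteCoeff_carrierConjEquiv_unitaryEquivPi_follandHermite` of the positive file) (★ `charProjL_thetaClass_eq_coeff_smul_of_hasSum_thetaClass` fed by ★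
  `hasSum_follandCoeff_smul_thetaClass_follandHermite`).
* §4 **`thetaClass_follandHermite_mem_of_uKernel_ne_zero_of_neg`** — THE DEFINITE STEP of the ladder at a negative place: if `Q` is a closed `R`-invariant subspace,
  `[θ_{h_β ⊗ Φ_f}] ∈ Q` and `uKernel (W at v₀) γ β ≠ 0` for some `u` at a negative place, then `[θ_{h_γ ⊗ Φ_f}] ∈ Q` (`η_D(u) · vac ≠ 0`, ★ `MpS.vac_ne_zero`).
Nothing printed is discharged; HC_CM is proved only modulo the 7 printed citations (2 remaining: hLiu418 = stmt-HodgeConjecture-24832, h413 =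
stmt-HodgeConjecture-24833) until rung 0 closes; count-neutral.

References (prose locators): Folland 1989 §1.7, §4.2 Prop. (4.39), Ch. 4 §5; Konno–Konno 2007 Lem. 5.2, Thm. 5.4; Kashiwara–Vergne 1978 §6;
Howe 1989 §3; Bröcker–tom Dieck 1985 III (5.10); Borel–Jacquet 1979 §4.6.
-/

set_option autoImplicit false
set_option linter.dupNamespace false

noncomputable section

open NumberField NumberField.InfinitePlace MeasureTheory IsDedekindDomain
open scoped Matrix ComplexOrder ENNReal TensorProduct SchwartzMap Kronecker Classical ComplexConjugate InnerProductSpace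

namespace Summit.HodgeConjecture.HodgeConjecture.Cruxes.HLiu418.F0LD1ThetaArchCompactStepNeg

open _root_.MeasureTheory
open Literature.NumberTheory.Automorphic Literature.NumberTheory.Automorphic.UnitaryGroup
open Literature.NumberTheory.Automorphic.UnitaryGroup.CotangentForms
open Literature.NumberTheory.Automorphic.IdeleClassGroup
open Literature.NumberTheory.Automorphic.Liu2021
open Literature.NumberTheory.Automorphic.Liu2021.Def411WeilCarriers
open Literature.NumberTheory.Automorphic.Liu2021.Def411WeilCarriersDoubling
open Literature.NumberTheory.Automorphic.Liu2021.CinfThetaTorus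
open Literature.NumberTheory.GelbartRogawski1991 Literature.NumberTheory.GelbartRogawski1991.UnitaryDualPair
open Literature.NumberTheory.GelbartRogawski1991.GRConstruction
open Literature.NumberTheory.Weil1964
open Literature.RepresentationTheory.Liu2021
open Literature.RepresentationTheory.HeisenbergGroup Literature.Analysis.SegalBargmann
open Literature.RepresentationTheory.KonnoKonno2007 Literature.RepresentationTheory.KonnoKonno2007.RealDualPair
open Literature.RepresentationTheory.CompactGroups
open Summit.HodgeConjecture.HodgeConjecture.Cruxes.HLiu418.F0LD1ThetaTransportKit
open Summit.HodgeConjecture.HodgeConjecture.Cruxes.HLiu418.F0LD2ThetaTensorClasses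
open Summit.HodgeConjecture.HodgeConjecture.Cruxes.HLiu418.F0LD2ThetaTorusEigenclass
open Summit.HodgeConjecture.HodgeConjecture.Cruxes.HLiu418.F0LD1ArchTorusHom
open Summit.HodgeConjecture.HodgeConjecture.Cruxes.HLiu418.F0LD1ThetaClassTorusExtraction
open Summit.HodgeConjecture.HodgeConjecture.Cruxes.HLiu418.F0LD1ThetaClassHermiteSum
open Summit.HodgeConjecture.HodgeConjecture.Cruxes.HLiu418.F0LD1ThetaSliceTorusProjector (charProj_restrict_mem_closedSubrep)
open Summit.HodgeConjecture.HodgeConjecture.Cruxes.HLiu418.F0LD1ThetaArchCompactStep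

/-! ## §1 The box identity at `k_{v₀,u}` for ANY `u` at a NEGATIVE place -/

section Box

variable (L : Type) [Field L] [NumberField L] [IsCMField L] {N M n : ℕ} (e : Fin N × Fin M ≃ Fin n)
  (dV : Fin N → L) (hdV : ∀ i, IsCMField.complexConj L (dV i) = dV i) (hdV0 : ∀ i, dV i ≠ 0)
  (dW : Fin M → L) (hdW : ∀ i, IsCMField.complexConj L (dW i) = dW i) (hdW0 : ∀ i, dW i ≠ 0)
  (v₀ : {v : InfinitePlace (Fp L) // v.IsReal})

include hdV0 hdW0 in
set_option maxHeartbeats 800000 in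
/-- **THE BOX IDENTITY AT `k_{v₀,u}`, ANY `u`, POSITIVE PLACE**: `frameD^* sectionD(k_{v₀,u}) (frameD^*)⁻¹ (R_{e₂}(h^V_{β₁} ⊠ h^V_{β₂}))
= R_{e₂}((frameV^* μ₀(W at v₀) (frameV^*)⁻¹ h^V_{β₁}) ⊠ h^V_{β₂})` with `W = D (u ⊗ 1)^e D⁻¹` (`hW`, the shape of ★ `exists_sectionD_archKPlace_apply_of_neg`;
two unitaries with these entries are equal) — Folland's section acts on the first box factor through the Fock rotation of `W`; its vacuum coefficient is
`1` at a positive place. [cite: Folland1989, §4.2 Prop. (4.39)] [cite: KonnoKonno2007, Lem. 5.2] -/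
theorem carrierConjEquiv_frameD_sectionD_archKPlace_of_neg (u : UnitaryGroup.archLocal L N (Matrix.diagonal dV) (cmPlaceOver L v₀))
    (hneg : ∀ k : Fin n, ¬ 0 < signVec (cmPlaceOver L) (cmGramEntry L e dV hdV dW hdW) (imagUnit L) v₀ k)
    (W : Matrix.unitaryGroup (Fin n) ℂ)
    (hW : ∀ i i' : Fin n, (W : Matrix (Fin n) (Fin n) ℂ) i i' =
        (((sqrtAbs (signVec (cmPlaceOver L) (cmGramEntry L e dV hdV dW hdW) (imagUnit L) v₀) i : ℝ) : ℂ)) *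
          Matrix.reindex e e
            ((((u : UnitaryGroup.archLocal L N (Matrix.diagonal dV) (cmPlaceOver L v₀)) : GL (Fin N) ℂ) : Matrix (Fin N) (Fin N) ℂ) ⊗ₖ
              (1 : Matrix (Fin M) (Fin M) ℂ)) i i' *
          (((sqrtAbs (signVec (cmPlaceOver L) (cmGramEntry L e dV hdV dW hdW) (imagUnit L) v₀) i' : ℝ) : ℂ))⁻¹)
    (β₁ β₂ : (Fin n × {v : InfinitePlace (Fp L) // v.IsReal}) →₀ ℕ) :
    carrierConjEquiv (frameD L e dV hdV hdV0 dW hdW hdW0) (sectionD L e dV hdV hdV0 dW hdW hdW0 (archKPlace L e dV hdV dW hdW v₀ u)).1.2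
        (schwartzReindexCLM (Fp L) (e₂ (n := n))
          (archBoxTensor (follandHermite (frameV L e dV hdV hdV0 dW hdW hdW0) β₁) (follandHermite (frameV L e dV hdV hdV0 dW hdW hdW0) β₂))) =
      MpS.vac (sectionD L e dV hdV hdV0 dW hdW hdW0 (archKPlace L e dV hdV dW hdW v₀ u)) •
        schwartzReindexCLM (Fp L) (e₂ (n := n))
          (archBoxTensor
            (carrierConjEquiv (frameV L e dV hdV hdV0 dW hdW hdW0) (unitaryEquivPi (placeBlock (Pi.mulSingle v₀ W)))
              (follandHermite (frameV L e dV hdV hdV0 dW hdW hdW0) β₁))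
            (follandHermite (frameV L e dV hdV hdV0 dW hdW hdW0) β₂)) := by
  obtain ⟨W₀, hW₀, hop⟩ := exists_sectionD_archKPlace_apply_of_neg L e dV hdV hdV0 dW hdW hdW0 v₀ u hneg
  have hWW : W = W₀ := Subtype.ext (Matrix.ext fun i i' => (hW i i').trans (hW₀ i i').symm)
  subst hWW
  have hβII := carrierConjEquiv_frameD_placeBlock_mulSingle_doubled_archBoxTensor L e dV hdV hdV0 dW hdW hdW0 W v₀ β₁ β₂
  rw [carrierConjEquiv_apply, unitaryEquivPi_apply] at hβII
  rw [carrierConjEquiv_apply, hop, map_smul, hβII]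

end Box


/-! ## §2 The class identity at a negative place: `R(k) [θ_{h_β ⊗ Φ_f}] = (η_D(u) · vac) • [θ_{(μ₀(W at v₀))^{frameV} h_β ⊗ Φ_f}]` -/

section Covariance


variable (L : Type) [Field L] [NumberField L] [IsCMField L] (N : ℕ) (H : Matrix (Fin N) (Fin N) L)
  {n' : ℕ} (e₁ : Fin N × Fin 1 ≃ Fin n') (dV : Fin N → L) (hdV : ∀ i, IsCMField.complexConj L (dV i) = dV i)
  (hdV0 : ∀ i, dV i ≠ 0)
  (ιA : (adelicGroupData (↥(maximalRealSubfield L)) L (IsCMField.complexConj L) N H).Adelic →*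
    ↥(UnitaryGroup.adelic (↥(maximalRealSubfield L)) L (IsCMField.complexConj L) N (Matrix.diagonal dV)))
  (hιA : Continuous ιA ∧ ∀ ⦃γ : (adelicGroupData (↥(maximalRealSubfield L)) L (IsCMField.complexConj L) N H).Adelic⦄,
    γ ∈ (UnitaryGroup.toAdelic (↥(maximalRealSubfield L)) L (IsCMField.complexConj L) N H).range →
      ιA γ ∈ (UnitaryGroup.toAdelic (↥(maximalRealSubfield L)) L (IsCMField.complexConj L) N (Matrix.diagonal dV)).range)
  (μ : Literature.NumberTheory.Automorphic.IdeleClassGroup L →ₜ* Circle) (hμ : IsConjugateSymplectic L μ) (a : (↥(maximalRealSubfield L))ˣ)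
  (hρ : HasThetaMajorants fun
      (p : ↥(UnitaryGroup.adelic (↥(maximalRealSubfield L)) L (IsCMField.complexConj L) N (Matrix.diagonal dV)) ×
        ↥(UnitaryGroup.adelic (↥(maximalRealSubfield L)) L (IsCMField.complexConj L) 1 (JW (↥(maximalRealSubfield L)) L a)))
      (Φ : piSchwartzBruhat (↥(maximalRealSubfield L)) (Fin n')) =>
        pairRep (↥(maximalRealSubfield L)) L (IsCMField.complexConj L) N 1 e₁ (Matrix.diagonal dV) (JW (↥(maximalRealSubfield L)) L a)
          (chiSplittingLine L e₁ dV hdV hdV0 (toHeckeCharacter L μ) (isUnitary_toHeckeCharacter L μ)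
            ((isOscillatorChar_toHeckeCharacter_iff μ).mpr hμ) (TW (↥(maximalRealSubfield L)) a)
            (isUnit_det_TW (↥(maximalRealSubfield L)) a) (JW (↥(maximalRealSubfield L)) L a) (JW_eq (↥(maximalRealSubfield L)) L a))
          p Φ)
  [CompactSpace (↥(UnitaryGroup.adelic (↥(maximalRealSubfield L)) L (IsCMField.complexConj L) N (Matrix.diagonal dV)) ⧸
    (UnitaryGroup.toAdelic (↥(maximalRealSubfield L)) L (IsCMField.complexConj L) N (Matrix.diagonal dV)).range)]
  [MeasurableSpace (↥(UnitaryGroup.adelic (↥(maximalRealSubfield L)) L (IsCMField.complexConj L) 1 (JW (↥(maximalRealSubfield L)) L a)) ⧸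
    (UnitaryGroup.toAdelic (↥(maximalRealSubfield L)) L (IsCMField.complexConj L) 1 (JW (↥(maximalRealSubfield L)) L a)).range)]
  (μW : Measure (↥(UnitaryGroup.adelic (↥(maximalRealSubfield L)) L (IsCMField.complexConj L) 1 (JW (↥(maximalRealSubfield L)) L a)) ⧸
    (UnitaryGroup.toAdelic (↥(maximalRealSubfield L)) L (IsCMField.complexConj L) 1 (JW (↥(maximalRealSubfield L)) L a)).range))
  (f : C((↥(UnitaryGroup.adelic (↥(maximalRealSubfield L)) L (IsCMField.complexConj L) 1 (JW (↥(maximalRealSubfield L)) L a)) ⧸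
    (UnitaryGroup.toAdelic (↥(maximalRealSubfield L)) L (IsCMField.complexConj L) 1 (JW (↥(maximalRealSubfield L)) L a)).range), ℂ))
  [BorelSpace (↥(UnitaryGroup.adelic (↥(maximalRealSubfield L)) L (IsCMField.complexConj L) 1 (JW (↥(maximalRealSubfield L)) L a)) ⧸
    (UnitaryGroup.toAdelic (↥(maximalRealSubfield L)) L (IsCMField.complexConj L) 1 (JW (↥(maximalRealSubfield L)) L a)).range)]
  [IsFiniteMeasure μW]
  [CompactSpace (adelicGroupData (↥(maximalRealSubfield L)) L (IsCMField.complexConj L) N H).automorphicQuotient]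
  (ν : Measure (adelicGroupData (↥(maximalRealSubfield L)) L (IsCMField.complexConj L) N H).automorphicQuotient) [IsFiniteMeasure ν]
  [SMulInvariantMeasure (adelicGroupData (↥(maximalRealSubfield L)) L (IsCMField.complexConj L) N H).Adelic
    (adelicGroupData (↥(maximalRealSubfield L)) L (IsCMField.complexConj L) N H).automorphicQuotient ν]

include hιA

set_option maxHeartbeats 1600000 in
-- (the line telescope of ★ T2 is large; the rewrites are few)
/-- **A COMPACT ELEMENT AT A DEFINITE PLACE ACTS ON A HERMITE THETA CLASS THROUGH THE FOCK ROTATION OF ITS FRAME.**  Let `v₀` be a real place of `L⁺` with the pair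
form positive there (`hpos`), `w₀ = cmPlaceOver L v₀`, `u ∈ U(σ_{w₀} diag dV)(ℂ)` ANY element, `W ∈ U(n′)` its matrix in the scaled Folland frame (`hW`), `τ` a type of the
splitting character (`hτ`, `hodd`), and `k ∈ U(H)(𝔸)` ANY element with `ιA k = adelicSingle w₀ u`.  Then for every Hermite multi-index `β` and finite vector `Φ_f`:
`R(k) [Θ̃_{E(h^V_β ⊗ Φ_f)}(f) ∘ ιA] = η_D(u) • [Θ̃_{E((frameV^* μ₀(W at v₀) (frameV^*)⁻¹ h^V_β) ⊗ Φ_f)}(f) ∘ ιA]` in `L²([U(H)], ν)`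
(★ K1 `rightRegular_toLp_lineThetaLift`; §1 + ★ T2 `pairRep_chiSplittingLine_adelicSingle_tmul_of_box`). [cite: Folland1989, §4.2 Prop. (4.39)]
[cite: KonnoKonno2007, Lem. 5.2, Thm. 5.4] [cite: BorelJacquet1979, §4.1, §4.6] -/
theorem rightRegular_toLp_lineThetaLift_follandHermite_of_eq_adelicSingle_of_neg (v₀ : {v : InfinitePlace (↥(maximalRealSubfield L)) // v.IsReal})
    {τ : InfinitePlace L → ℤ} (hτ : (toHeckeCharacter L μ).HasUnitaryArchType τ 0) (hodd : ∀ w, Odd (τ w))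
    (hneg : ∀ k : Fin n', ¬ 0 < signVec (cmPlaceOver L) (cmGramEntry L e₁ dV hdV (lineW L (TW (Fp L) a)) (complexConj_lineW L (TW (Fp L) a))) (imagUnit L) v₀ k)
    (u : UnitaryGroup.archLocal L N (Matrix.diagonal dV) (cmPlaceOver L v₀))
    (W : Matrix.unitaryGroup (Fin n') ℂ)
    (hW : ∀ i i' : Fin n', (W : Matrix (Fin n') (Fin n') ℂ) i i' =
        (((sqrtAbs (signVec (cmPlaceOver L) (cmGramEntry L e₁ dV hdV (lineW L (TW (Fp L) a)) (complexConj_lineW L (TW (Fp L) a))) (imagUnit L) v₀) i : ℝ) : ℂ)) *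
          Matrix.reindex e₁ e₁
            ((((u : UnitaryGroup.archLocal L N (Matrix.diagonal dV) (cmPlaceOver L v₀)) : GL (Fin N) ℂ) : Matrix (Fin N) (Fin N) ℂ) ⊗ₖ
              (1 : Matrix (Fin 1) (Fin 1) ℂ)) i i' *
          (((sqrtAbs (signVec (cmPlaceOver L) (cmGramEntry L e₁ dV hdV (lineW L (TW (Fp L) a)) (complexConj_lineW L (TW (Fp L) a))) (imagUnit L) v₀) i' : ℝ) : ℂ))⁻¹)
    (k : (adelicGroupData (↥(maximalRealSubfield L)) L (IsCMField.complexConj L) N H).Adelic)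
    (hk : ιA k = UnitaryGroup.adelicSingle (↥(maximalRealSubfield L)) L (IsCMField.complexConj L) N (Matrix.diagonal dV) (IsCMField.complexConj_ne_one L)
      (complexConj_smul_infinitePlace L) (cmPlaceOver L v₀) u)
    (β : (Fin n' × {v : InfinitePlace (↥(maximalRealSubfield L)) // v.IsReal}) →₀ ℕ) (Φf : FinSB (↥(maximalRealSubfield L)) (Fin n')) :
    (adelicGroupData (↥(maximalRealSubfield L)) L (IsCMField.complexConj L) N H).rightRegular ν k
        (MemLp.toLp _ (memLp_toQuotFun_lineThetaLift L N H e₁ dV hdV hdV0 ιA hιA μ hμ a hρ μW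
          (piSchwartzBruhatEquiv (↥(maximalRealSubfield L)) (Fin n')
            (follandHermite (frameV L e₁ dV hdV hdV0 (lineW L (TW (Fp L) a)) (complexConj_lineW L (TW (Fp L) a))
              (lineW_ne_zero L (TW (Fp L) a) (isUnit_det_TW (Fp L) a))) β ⊗ₜ Φf)) f ν 2)) =
      ((((etaD L e₁ dV hdV (lineW L (TW (Fp L) a)) (complexConj_lineW L (TW (Fp L) a)) τ
            (archKPlace L e₁ dV hdV (lineW L (TW (Fp L) a)) (complexConj_lineW L (TW (Fp L) a)) v₀ u) : ℂˣ) : ℂ)) *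
          MpS.vac (sectionD L e₁ dV hdV hdV0 (lineW L (TW (Fp L) a)) (complexConj_lineW L (TW (Fp L) a)) (lineW_ne_zero L (TW (Fp L) a) (isUnit_det_TW (Fp L) a))
            (archKPlace L e₁ dV hdV (lineW L (TW (Fp L) a)) (complexConj_lineW L (TW (Fp L) a)) v₀ u))) •
        MemLp.toLp _ (memLp_toQuotFun_lineThetaLift L N H e₁ dV hdV hdV0 ιA hιA μ hμ a hρ μW
          (piSchwartzBruhatEquiv (↥(maximalRealSubfield L)) (Fin n')
            (carrierConjEquiv (frameV L e₁ dV hdV hdV0 (lineW L (TW (Fp L) a)) (complexConj_lineW L (TW (Fp L) a))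
                (lineW_ne_zero L (TW (Fp L) a) (isUnit_det_TW (Fp L) a))) (unitaryEquivPi (placeBlock (Pi.mulSingle v₀ W)))
              (follandHermite (frameV L e₁ dV hdV hdV0 (lineW L (TW (Fp L) a)) (complexConj_lineW L (TW (Fp L) a))
                (lineW_ne_zero L (TW (Fp L) a) (isUnit_det_TW (Fp L) a))) β) ⊗ₜ Φf)) f ν 2) := by
  set eV := frameV L e₁ dV hdV hdV0 (lineW L (TW (Fp L) a)) (complexConj_lineW L (TW (Fp L) a))
    (lineW_ne_zero L (TW (Fp L) a) (isUnit_det_TW (Fp L) a)) with heV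
  -- the Weil side: `ω((u at w₀), 1) E(h^V_β ⊗ Φ_f) = η • E((μ₀(W))^{eV} h^V_β ⊗ Φ_f)` (§1 with `β₂ = 0`)
  have hbox := carrierConjEquiv_frameD_sectionD_archKPlace_of_neg L e₁ dV hdV hdV0 (lineW L (TW (Fp L) a)) (complexConj_lineW L (TW (Fp L) a))
    (lineW_ne_zero L (TW (Fp L) a) (isUnit_det_TW (Fp L) a)) v₀ u hneg W hW β 0
  -- the equivariance of the class along `ιA`
  have hE := rightRegular_toLp_lineThetaLift L N H e₁ dV hdV hdV0 ιA hιA μ hμ a hρ μW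
    (piSchwartzBruhatEquiv (Fp L) (Fin n') (follandHermite eV β ⊗ₜ Φf)) f ν k
  rw [hk] at hE
  by_cases hΦf : Φf = 0
  · -- trivial case `Φ_f = 0`: both sides are `0`
    subst hΦf
    rw [TensorProduct.tmul_zero, TensorProduct.tmul_zero, map_zero, ← zero_smul ℂ (0 : piSchwartzBruhat (Fp L) (Fin n')),
      toLp_lineThetaLift_smul_left L N H e₁ dV hdV hdV0 ιA hιA μ hμ a hρ μW f ν, zero_smul, map_zero, smul_zero]
  have hne : piSchwartzBruhatEquiv (Fp L) (Fin n') (follandHermite eV 0 ⊗ₜ Φf) ≠ 0 :=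
    piSchwartzBruhatEquiv_tmul_ne_zero (gaussianV_ne_zero L e₁ dV hdV hdV0 _ _ _) hΦf
  have hT2 := pairRep_chiSplittingLine_adelicSingle_tmul_of_box L dV hdV hdV0 v₀ e₁ (isUnitary_toHeckeCharacter L μ)
    ((isOscillatorChar_toHeckeCharacter_iff μ).mpr hμ) hτ hodd (TW (Fp L) a) (isUnit_det_TW (Fp L) a) (JW (Fp L) L a) (JW_eq (Fp L) L a) u hbox Φf hne
  rw [toLp_lineThetaLift_congr L N H e₁ dV hdV hdV0 ιA hιA μ hμ a hρ μW f ν hT2,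
    toLp_lineThetaLift_smul_left L N H e₁ dV hdV hdV0 ιA hιA μ hμ a hρ μW f ν] at hE
  exact hE

set_option maxHeartbeats 1600000 in
/-- **§3 THE FULL-TORUS PROJECTOR EXTRACTS THE ROTATED HERMITE COEFFICIENT**: with `P_γ = Schur.charProjL μT κ_γ ((rightRegular ν).restrict kT)` the character projector
of the ★ torus hom `kT` (`hkT`, ★ `F0LD1ArchTorusHom`) and the one-dimensional unitary `κ_γ` of type `c_γ` (`hκc`), and `k`, `u`, `W` as in §2:
`P_γ (R(k) [θ_{h_β ⊗ Φ_f}]) = (η_D(u) · uKernel (W at v₀) γ β) • [θ_{h_γ ⊗ Φ_f}]` (§2, ★ `charProjL_thetaClass_eq_coeff_smul_of_hasSum_thetaClass` fed by ★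
`hasSum_follandCoeff_smul_thetaClass_follandHermite`, §2′). [cite: BrockerTomDieck1985, III (5.10)] [cite: Folland1989, §1.7, Prop. (4.39)] [cite: KonnoKonno2007, Thm. 5.4] -/
theorem charProjL_rightRegular_thetaClass_follandHermite_of_neg (v₀ : {v : InfinitePlace (↥(maximalRealSubfield L)) // v.IsReal})
    {τ : InfinitePlace L → ℤ} (hτ : (toHeckeCharacter L μ).HasUnitaryArchType τ 0) (hodd : ∀ w, Odd (τ w))
    (hneg : ∀ k : Fin n', ¬ 0 < signVec (cmPlaceOver L) (cmGramEntry L e₁ dV hdV (lineW L (TW (Fp L) a)) (complexConj_lineW L (TW (Fp L) a))) (imagUnit L) v₀ k)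
    (u : UnitaryGroup.archLocal L N (Matrix.diagonal dV) (cmPlaceOver L v₀))
    (W : Matrix.unitaryGroup (Fin n') ℂ)
    (hW : ∀ i i' : Fin n', (W : Matrix (Fin n') (Fin n') ℂ) i i' =
        (((sqrtAbs (signVec (cmPlaceOver L) (cmGramEntry L e₁ dV hdV (lineW L (TW (Fp L) a)) (complexConj_lineW L (TW (Fp L) a))) (imagUnit L) v₀) i : ℝ) : ℂ)) *
          Matrix.reindex e₁ e₁
            ((((u : UnitaryGroup.archLocal L N (Matrix.diagonal dV) (cmPlaceOver L v₀)) : GL (Fin N) ℂ) : Matrix (Fin N) (Fin N) ℂ) ⊗ₖ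
              (1 : Matrix (Fin 1) (Fin 1) ℂ)) i i' *
          (((sqrtAbs (signVec (cmPlaceOver L) (cmGramEntry L e₁ dV hdV (lineW L (TW (Fp L) a)) (complexConj_lineW L (TW (Fp L) a))) (imagUnit L) v₀) i' : ℝ) : ℂ))⁻¹)
    (k : (adelicGroupData (↥(maximalRealSubfield L)) L (IsCMField.complexConj L) N H).Adelic)
    (hk : ιA k = UnitaryGroup.adelicSingle (↥(maximalRealSubfield L)) L (IsCMField.complexConj L) N (Matrix.diagonal dV) (IsCMField.complexConj_ne_one L)
      (complexConj_smul_infinitePlace L) (cmPlaceOver L v₀) u)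
    (β γ : (Fin n' × {v : InfinitePlace (↥(maximalRealSubfield L)) // v.IsReal}) →₀ ℕ) (Φf : FinSB (↥(maximalRealSubfield L)) (Fin n'))
    (kT : (({v : InfinitePlace (↥(maximalRealSubfield L)) // v.IsReal}) → Fin N → Circle) →*
      (adelicGroupData (↥(maximalRealSubfield L)) L (IsCMField.complexConj L) N H).Adelic)
    (hkT : ∀ (v : {v : InfinitePlace (↥(maximalRealSubfield L)) // v.IsReal}) (x : Fin N → Circle),
      ιA (kT (Pi.mulSingle v x)) = UnitaryGroup.adelicSingle (↥(maximalRealSubfield L)) L (IsCMField.complexConj L) N (Matrix.diagonal dV)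
        (IsCMField.complexConj_ne_one L) (complexConj_smul_infinitePlace L) (cmPlaceOver L v)
        ⟨circleDiagonal N x, circleDiagonal_mem_archLocal_diagonal L N dV (cmPlaceOver L v) x⟩)
    [MeasurableSpace (({v : InfinitePlace (↥(maximalRealSubfield L)) // v.IsReal}) → Fin N → Circle)] [BorelSpace (({v : InfinitePlace (↥(maximalRealSubfield L)) // v.IsReal}) → Fin N → Circle)]
    (μT : Measure (({v : InfinitePlace (↥(maximalRealSubfield L)) // v.IsReal}) → Fin N → Circle)) [IsProbabilityMeasure μT] [μT.IsMulLeftInvariant]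
    {κ : ContRepresentation ℂ (({v : InfinitePlace (↥(maximalRealSubfield L)) // v.IsReal}) → Fin N → Circle) ℂ}
    (hκ : Continuous (κ : (({v : InfinitePlace (↥(maximalRealSubfield L)) // v.IsReal}) → Fin N → Circle) → ℂ →L[ℂ] ℂ)) [κ.toRepresentation.IsIrreducible]
    (hκu : ∀ (g : (({v : InfinitePlace (↥(maximalRealSubfield L)) // v.IsReal}) → Fin N → Circle)) (x y : ℂ), ⟪κ g x, κ g y⟫_ℂ = ⟪x, y⟫_ℂ)
    (hκc : ∀ z, κ z 1 = (∏ v : {v : InfinitePlace (↥(maximalRealSubfield L)) // v.IsReal}, ∏ p : Fin N, (((z v p : Circle) : ℂ)) ^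
        (if 0 < signVec (cmPlaceOver L) (cmGramEntry L e₁ dV hdV (lineW L (TW (Fp L) a)) (complexConj_lineW L (TW (Fp L) a))) (imagUnit L) v (e₁ (p, 0))
          then (τ (cmPlaceOver L v).1 + 1) / 2 + γ (e₁ (p, 0), v)
          else (τ (cmPlaceOver L v).1 + 1) / 2 - 1 - γ (e₁ (p, 0), v))))
    (hU : ∀ w, Continuous fun z : (({v : InfinitePlace (↥(maximalRealSubfield L)) // v.IsReal}) → Fin N → Circle) => (((adelicGroupData (↥(maximalRealSubfield L)) L (IsCMField.complexConj L) N H).rightRegular ν).restrict kT) z w)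
    (hUu : ∀ (z : (({v : InfinitePlace (↥(maximalRealSubfield L)) // v.IsReal}) → Fin N → Circle)) (w w' : Lp ℂ 2 ν), ⟪(((adelicGroupData (↥(maximalRealSubfield L)) L (IsCMField.complexConj L) N H).rightRegular ν).restrict kT) z w, (((adelicGroupData (↥(maximalRealSubfield L)) L (IsCMField.complexConj L) N H).rightRegular ν).restrict kT) z w'⟫_ℂ = ⟪w, w'⟫_ℂ) :
    Schur.charProjL μT κ (((adelicGroupData (↥(maximalRealSubfield L)) L (IsCMField.complexConj L) N H).rightRegular ν).restrict kT) hκ hκu hU hUu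
        ((adelicGroupData (↥(maximalRealSubfield L)) L (IsCMField.complexConj L) N H).rightRegular ν k
          (MemLp.toLp _ (memLp_toQuotFun_lineThetaLift L N H e₁ dV hdV hdV0 ιA hιA μ hμ a hρ μW
            (piSchwartzBruhatEquiv (↥(maximalRealSubfield L)) (Fin n')
              (follandHermite (frameV L e₁ dV hdV hdV0 (lineW L (TW (Fp L) a)) (complexConj_lineW L (TW (Fp L) a))
                (lineW_ne_zero L (TW (Fp L) a) (isUnit_det_TW (Fp L) a))) β ⊗ₜ Φf)) f ν 2))) =
      ((((etaD L e₁ dV hdV (lineW L (TW (Fp L) a)) (complexConj_lineW L (TW (Fp L) a)) τ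
            (archKPlace L e₁ dV hdV (lineW L (TW (Fp L) a)) (complexConj_lineW L (TW (Fp L) a)) v₀ u) : ℂˣ) : ℂ)) *
          MpS.vac (sectionD L e₁ dV hdV hdV0 (lineW L (TW (Fp L) a)) (complexConj_lineW L (TW (Fp L) a)) (lineW_ne_zero L (TW (Fp L) a) (isUnit_det_TW (Fp L) a))
            (archKPlace L e₁ dV hdV (lineW L (TW (Fp L) a)) (complexConj_lineW L (TW (Fp L) a)) v₀ u)) *
          uKernel (placeBlock (Pi.mulSingle v₀ W)) γ β) •
        MemLp.toLp _ (memLp_toQuotFun_lineThetaLift L N H e₁ dV hdV hdV0 ιA hιA μ hμ a hρ μW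
          (piSchwartzBruhatEquiv (↥(maximalRealSubfield L)) (Fin n')
            (follandHermite (frameV L e₁ dV hdV hdV0 (lineW L (TW (Fp L) a)) (complexConj_lineW L (TW (Fp L) a))
              (lineW_ne_zero L (TW (Fp L) a) (isUnit_det_TW (Fp L) a))) γ ⊗ₜ Φf)) f ν 2) := by
  rw [rightRegular_toLp_lineThetaLift_follandHermite_of_eq_adelicSingle_of_neg L N H e₁ dV hdV hdV0 ιA hιA μ hμ a hρ μW f ν v₀ hτ hodd hneg u W hW k hk β Φf,
    map_smul,
    charProjL_thetaClass_eq_coeff_smul_of_hasSum_thetaClass L N H e₁ dV hdV hdV0 ιA hιA μ hμ a hρ μW f ν hτ hodd γ Φf kT hkT μT hκ hκu hκc hU hUu _ _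
      (hasSum_follandCoeff_smul_thetaClass_follandHermite L N H e₁ dV hdV hdV0 ιA hιA μ hμ a hρ μW f ν
        (frameV L e₁ dV hdV hdV0 (lineW L (TW (Fp L) a)) (complexConj_lineW L (TW (Fp L) a)) (lineW_ne_zero L (TW (Fp L) a) (isUnit_det_TW (Fp L) a))) Φf _),
    hermiteCoeff_carrierConjEquiv_unitaryEquivPi_follandHermite, smul_smul]

set_option maxHeartbeats 1600000 in
/-- **§4 THE DEFINITE STEP OF THE ARCHIMEDEAN LADDER.**  If `Q ⊆ L²([U(H)], ν)` is a closed `R`-invariant subspace containing the Hermite theta class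
`[θ_{h_β ⊗ Φ_f}]`, and some `u ∈ U(σ_{w₀} diag dV)(ℂ)` at a real place `v₀` where the pair form is positive has `uKernel (W at v₀) γ β ≠ 0` (a non-zero
`γ`-th Hermite coefficient of the rotated `h_β`), then `[θ_{h_γ ⊗ Φ_f}] ∈ Q`: `R(k)` and the projector `P_γ` preserve `Q` (★ `charProj_restrict_mem_closedSubrep`)
and `P_γ (R(k) [θ_{h_β ⊗ Φ_f}])` is a NON-ZERO multiple of `[θ_{h_γ ⊗ Φ_f}]` (§3, `η_D(u) ∈ ℂˣ`). [cite: Folland1989, Ch. 4 §5; Prop. (4.39)]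
[cite: KashiwaraVergne1978, §6] [cite: Howe1989, §3] -/
theorem thetaClass_follandHermite_mem_of_uKernel_ne_zero_of_neg (v₀ : {v : InfinitePlace (↥(maximalRealSubfield L)) // v.IsReal})
    {τ : InfinitePlace L → ℤ} (hτ : (toHeckeCharacter L μ).HasUnitaryArchType τ 0) (hodd : ∀ w, Odd (τ w))
    (hneg : ∀ k : Fin n', ¬ 0 < signVec (cmPlaceOver L) (cmGramEntry L e₁ dV hdV (lineW L (TW (Fp L) a)) (complexConj_lineW L (TW (Fp L) a))) (imagUnit L) v₀ k)
    (u : UnitaryGroup.archLocal L N (Matrix.diagonal dV) (cmPlaceOver L v₀))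
    (W : Matrix.unitaryGroup (Fin n') ℂ)
    (hW : ∀ i i' : Fin n', (W : Matrix (Fin n') (Fin n') ℂ) i i' =
        (((sqrtAbs (signVec (cmPlaceOver L) (cmGramEntry L e₁ dV hdV (lineW L (TW (Fp L) a)) (complexConj_lineW L (TW (Fp L) a))) (imagUnit L) v₀) i : ℝ) : ℂ)) *
          Matrix.reindex e₁ e₁
            ((((u : UnitaryGroup.archLocal L N (Matrix.diagonal dV) (cmPlaceOver L v₀)) : GL (Fin N) ℂ) : Matrix (Fin N) (Fin N) ℂ) ⊗ₖ
              (1 : Matrix (Fin 1) (Fin 1) ℂ)) i i' *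
          (((sqrtAbs (signVec (cmPlaceOver L) (cmGramEntry L e₁ dV hdV (lineW L (TW (Fp L) a)) (complexConj_lineW L (TW (Fp L) a))) (imagUnit L) v₀) i' : ℝ) : ℂ))⁻¹)
    (k : (adelicGroupData (↥(maximalRealSubfield L)) L (IsCMField.complexConj L) N H).Adelic)
    (hk : ιA k = UnitaryGroup.adelicSingle (↥(maximalRealSubfield L)) L (IsCMField.complexConj L) N (Matrix.diagonal dV) (IsCMField.complexConj_ne_one L)
      (complexConj_smul_infinitePlace L) (cmPlaceOver L v₀) u)
    (β γ : (Fin n' × {v : InfinitePlace (↥(maximalRealSubfield L)) // v.IsReal}) →₀ ℕ) (Φf : FinSB (↥(maximalRealSubfield L)) (Fin n'))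
    (hne : uKernel (placeBlock (Pi.mulSingle v₀ W)) γ β ≠ 0)
    (kT : (({v : InfinitePlace (↥(maximalRealSubfield L)) // v.IsReal}) → Fin N → Circle) →*
      (adelicGroupData (↥(maximalRealSubfield L)) L (IsCMField.complexConj L) N H).Adelic)
    (hkT : ∀ (v : {v : InfinitePlace (↥(maximalRealSubfield L)) // v.IsReal}) (x : Fin N → Circle),
      ιA (kT (Pi.mulSingle v x)) = UnitaryGroup.adelicSingle (↥(maximalRealSubfield L)) L (IsCMField.complexConj L) N (Matrix.diagonal dV)
        (IsCMField.complexConj_ne_one L) (complexConj_smul_infinitePlace L) (cmPlaceOver L v)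
        ⟨circleDiagonal N x, circleDiagonal_mem_archLocal_diagonal L N dV (cmPlaceOver L v) x⟩)
    [MeasurableSpace (({v : InfinitePlace (↥(maximalRealSubfield L)) // v.IsReal}) → Fin N → Circle)] [BorelSpace (({v : InfinitePlace (↥(maximalRealSubfield L)) // v.IsReal}) → Fin N → Circle)]
    (μT : Measure (({v : InfinitePlace (↥(maximalRealSubfield L)) // v.IsReal}) → Fin N → Circle)) [IsProbabilityMeasure μT] [μT.IsMulLeftInvariant]
    {κ : ContRepresentation ℂ (({v : InfinitePlace (↥(maximalRealSubfield L)) // v.IsReal}) → Fin N → Circle) ℂ}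
    (hκ : Continuous (κ : (({v : InfinitePlace (↥(maximalRealSubfield L)) // v.IsReal}) → Fin N → Circle) → ℂ →L[ℂ] ℂ)) [κ.toRepresentation.IsIrreducible]
    (hκu : ∀ (g : (({v : InfinitePlace (↥(maximalRealSubfield L)) // v.IsReal}) → Fin N → Circle)) (x y : ℂ), ⟪κ g x, κ g y⟫_ℂ = ⟪x, y⟫_ℂ)
    (hκc : ∀ z, κ z 1 = (∏ v : {v : InfinitePlace (↥(maximalRealSubfield L)) // v.IsReal}, ∏ p : Fin N, (((z v p : Circle) : ℂ)) ^
        (if 0 < signVec (cmPlaceOver L) (cmGramEntry L e₁ dV hdV (lineW L (TW (Fp L) a)) (complexConj_lineW L (TW (Fp L) a))) (imagUnit L) v (e₁ (p, 0))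
          then (τ (cmPlaceOver L v).1 + 1) / 2 + γ (e₁ (p, 0), v)
          else (τ (cmPlaceOver L v).1 + 1) / 2 - 1 - γ (e₁ (p, 0), v))))
    (hU : ∀ w, Continuous fun z : (({v : InfinitePlace (↥(maximalRealSubfield L)) // v.IsReal}) → Fin N → Circle) => (((adelicGroupData (↥(maximalRealSubfield L)) L (IsCMField.complexConj L) N H).rightRegular ν).restrict kT) z w)
    (hUu : ∀ (z : (({v : InfinitePlace (↥(maximalRealSubfield L)) // v.IsReal}) → Fin N → Circle)) (w w' : Lp ℂ 2 ν), ⟪(((adelicGroupData (↥(maximalRealSubfield L)) L (IsCMField.complexConj L) N H).rightRegular ν).restrict kT) z w, (((adelicGroupData (↥(maximalRealSubfield L)) L (IsCMField.complexConj L) N H).rightRegular ν).restrict kT) z w'⟫_ℂ = ⟪w, w'⟫_ℂ)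
    (Q : ContRepresentation.ClosedSubrep ((adelicGroupData (↥(maximalRealSubfield L)) L (IsCMField.complexConj L) N H).rightRegular ν))
    (hQ : MemLp.toLp _ (memLp_toQuotFun_lineThetaLift L N H e₁ dV hdV hdV0 ιA hιA μ hμ a hρ μW
            (piSchwartzBruhatEquiv (↥(maximalRealSubfield L)) (Fin n')
              (follandHermite (frameV L e₁ dV hdV hdV0 (lineW L (TW (Fp L) a)) (complexConj_lineW L (TW (Fp L) a))
                (lineW_ne_zero L (TW (Fp L) a) (isUnit_det_TW (Fp L) a))) β ⊗ₜ Φf)) f ν 2) ∈ Q) :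
    MemLp.toLp _ (memLp_toQuotFun_lineThetaLift L N H e₁ dV hdV hdV0 ιA hιA μ hμ a hρ μW
          (piSchwartzBruhatEquiv (↥(maximalRealSubfield L)) (Fin n')
            (follandHermite (frameV L e₁ dV hdV hdV0 (lineW L (TW (Fp L) a)) (complexConj_lineW L (TW (Fp L) a))
              (lineW_ne_zero L (TW (Fp L) a) (isUnit_det_TW (Fp L) a))) γ ⊗ₜ Φf)) f ν 2) ∈ Q := by
  -- `R(k)` and `P_γ` preserve `Q`
  have h1 := Q.apply_mem k hQ
  have h2 : Schur.charProjL μT κ (((adelicGroupData (↥(maximalRealSubfield L)) L (IsCMField.complexConj L) N H).rightRegular ν).restrict kT) hκ hκu hU hUu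
      ((adelicGroupData (↥(maximalRealSubfield L)) L (IsCMField.complexConj L) N H).rightRegular ν k
        (MemLp.toLp _ (memLp_toQuotFun_lineThetaLift L N H e₁ dV hdV hdV0 ιA hιA μ hμ a hρ μW
          (piSchwartzBruhatEquiv (↥(maximalRealSubfield L)) (Fin n')
            (follandHermite (frameV L e₁ dV hdV hdV0 (lineW L (TW (Fp L) a)) (complexConj_lineW L (TW (Fp L) a))
              (lineW_ne_zero L (TW (Fp L) a) (isUnit_det_TW (Fp L) a))) β ⊗ₜ Φf)) f ν 2))) ∈ Q := by
    rw [Schur.charProjL_apply]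
    exact charProj_restrict_mem_closedSubrep μT hκ _ kT hU Q h1
  rw [charProjL_rightRegular_thetaClass_follandHermite_of_neg L N H e₁ dV hdV hdV0 ιA hιA μ hμ a hρ μW f ν v₀ hτ hodd hneg u W hW k hk β γ Φf kT hkT μT hκ
    hκu hκc hU hUu] at h2
  -- a non-zero multiple
  have hc : ((((etaD L e₁ dV hdV (lineW L (TW (Fp L) a)) (complexConj_lineW L (TW (Fp L) a)) τ
            (archKPlace L e₁ dV hdV (lineW L (TW (Fp L) a)) (complexConj_lineW L (TW (Fp L) a)) v₀ u) : ℂˣ) : ℂ)) *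
          MpS.vac (sectionD L e₁ dV hdV hdV0 (lineW L (TW (Fp L) a)) (complexConj_lineW L (TW (Fp L) a)) (lineW_ne_zero L (TW (Fp L) a) (isUnit_det_TW (Fp L) a))
            (archKPlace L e₁ dV hdV (lineW L (TW (Fp L) a)) (complexConj_lineW L (TW (Fp L) a)) v₀ u)) *
          uKernel (placeBlock (Pi.mulSingle v₀ W)) γ β) ≠ 0 := mul_ne_zero (mul_ne_zero (Units.ne_zero _) (MpS.vac_ne_zero _)) hne
  have h3 := Q.toSubmodule.smul_mem ((((etaD L e₁ dV hdV (lineW L (TW (Fp L) a)) (complexConj_lineW L (TW (Fp L) a)) τ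
            (archKPlace L e₁ dV hdV (lineW L (TW (Fp L) a)) (complexConj_lineW L (TW (Fp L) a)) v₀ u) : ℂˣ) : ℂ)) *
          MpS.vac (sectionD L e₁ dV hdV hdV0 (lineW L (TW (Fp L) a)) (complexConj_lineW L (TW (Fp L) a)) (lineW_ne_zero L (TW (Fp L) a) (isUnit_det_TW (Fp L) a))
            (archKPlace L e₁ dV hdV (lineW L (TW (Fp L) a)) (complexConj_lineW L (TW (Fp L) a)) v₀ u)) *
          uKernel (placeBlock (Pi.mulSingle v₀ W)) γ β)⁻¹ h2
  rwa [smul_smul, inv_mul_cancel₀ hc, one_smul] at h3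

end Covariance

end Summit.HodgeConjecture.HodgeConjecture.Cruxes.HLiu418.F0LD1ThetaArchCompactStepNeg

end
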